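import Summits.PneNP.PneNP.Theorems.KarlinRubinMonotoneBlindDnfPlanted

/-!
# Route KarlinRubin, crux `MonotoneBlind` (stmt-PneNP-18027): numeric bounds for the DNF line (level 3a)

Elementary inequalities turning the per-term bounds of `KarlinRubinMonotoneBlindDnfPlanted.lean` into
`≤ 2 · (n^{c+2})⁻¹` for EVERY term, under four numeric hypotheses on `n`, the planted size `d = min k n` and
`L = ⌊log₂ n⌋` (all of which hold eventually when `k = ⌈n^{1/2-δ}⌉`, `δ > 0`; proved in the level-3b file):
`(2 L⁴ d)² ≤ n`, `12 (⌊√n⌋ + 1) d ≤ n`, `6 d ≤ ⌊√n⌋ + 1`, `c + 3 ≤ L` (and `n < 2^{L+1}`). Terms with `≤ L⁴` slots use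
the tail bound with `j = 2(c+2)`; terms with `> L⁴` slots use the large-term bound (`2^{-(s - C(⌊√s⌋,2))} ≤ 2^{-L²}`
and `C(v, ⌊√s⌋+1) (2d)^{⌊√s⌋+1} ≤ n^{⌊√s⌋+1}` from `m^m ≤ 3^m m!`).

* `pow_self_le_three_pow_mul_factorial`, `choose_mul_pow_le_pow_of_le` — `C(v,m) (2d)^m ≤ n^m` once `6vd ≤ nm`;
* `natCast_div_le_inv_of_mul_le` — `ℕ`-to-`ℝ≥0∞` transfer;
* `card_vertices_le_two_mul_card` — a term with `s` slots meets `≤ 2s` vertices;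
* `dnf_smallTerm_le_inv`, `dnf_largeTerm_half_pow_le_inv`, `dnf_largeTerm_tail_le_inv` — the three numeric bounds;
* `dnf_termBound_two_inv` — every term's heavy-witness term is `≤ 2 (n^{c+2})⁻¹` (threshold `t = C(2c+3, 2)`).

All `--supports stmt-PneNP-18027`; no definitions.
-/

set_option linter.dupNamespace false -- `Summit.PneNP.PneNP.…`: summit = sub-problem (D-0017)

namespace Summit.PneNP.PneNP.Theorems

open Finset
open scoped ENNReal
open Literature.Computability.Complexity
open Literature.Probability.RandomGraphs.PlantedClique

variable {n : ℕ}

/-! ### Arithmetic -/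

/-- `m^m ≤ 3^m · m!` (from `m^m / m! ≤ e^m` and `e < 3`). [folklore] -/
theorem pow_self_le_three_pow_mul_factorial (m : ℕ) : ((m : ℝ) ^ m) ≤ 3 ^ m * m.factorial := by
  have hfac : (0 : ℝ) < m.factorial := by exact_mod_cast m.factorial_pos
  have h := Real.pow_div_factorial_le_exp (x := (m : ℝ)) (Nat.cast_nonneg m) m
  rw [div_le_iff₀ hfac] at h
  have he : Real.exp (m : ℝ) ≤ 3 ^ m := by
    have h1 : Real.exp (m : ℝ) = Real.exp 1 ^ m := by rw [← Real.exp_nat_mul, mul_one]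
    rw [h1]
    exact pow_le_pow_left₀ (Real.exp_pos _).le (le_of_lt (lt_trans Real.exp_one_lt_d9 (by norm_num))) m
  calc ((m : ℝ) ^ m) ≤ Real.exp m * m.factorial := h
    _ ≤ 3 ^ m * m.factorial := by gcongr

/-- `C(v,m) (2d)^m ≤ n^m` as soon as `6 v d ≤ n m` (`m ≥ 1`): `C(v,m) ≤ v^m/m!` and `m! ≥ (m/3)^m`. [folklore] -/
theorem choose_mul_pow_le_pow_of_le (v d N m : ℕ) (hm : 0 < m) (h : 6 * v * d ≤ N * m) :
    v.choose m * (2 * d) ^ m ≤ N ^ m := by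
  have hfac : (0 : ℝ) < m.factorial := by exact_mod_cast m.factorial_pos
  have hmpos : (0 : ℝ) < m := by exact_mod_cast hm
  have hmm : (0 : ℝ) < (m : ℝ) ^ m := pow_pos hmpos m
  have h1 : ((v.choose m : ℕ) : ℝ) ≤ (v : ℝ) ^ m / m.factorial := Nat.choose_le_pow_div m v
  have h2 := pow_self_le_three_pow_mul_factorial m
  have hvd : (6 * v * d : ℝ) ≤ N * m := by exact_mod_cast h
  have key : ((v.choose m : ℕ) : ℝ) * (2 * d) ^ m ≤ (N : ℝ) ^ m := by
    calc ((v.choose m : ℕ) : ℝ) * (2 * d) ^ m ≤ (v : ℝ) ^ m / m.factorial * (2 * d) ^ m := by gcongr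
      _ ≤ (v : ℝ) ^ m * 3 ^ m / (m : ℝ) ^ m * (2 * d) ^ m := by
          gcongr ?_ * _
          rw [div_le_div_iff₀ hfac hmm]
          calc (v : ℝ) ^ m * (m : ℝ) ^ m ≤ (v : ℝ) ^ m * (3 ^ m * m.factorial) := by gcongr
            _ = (v : ℝ) ^ m * 3 ^ m * m.factorial := by ring
      _ = ((2 * d) * (3 * v) / m) ^ m := by
          rw [div_pow, mul_pow (2 * (d : ℝ)) (3 * v), mul_pow (3 : ℝ) v]
          ring
      _ ≤ (N * m / m) ^ m := by
          refine pow_le_pow_left₀ (by positivity) (div_le_div_of_nonneg_right ?_ hmpos.le) m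
          calc (2 * (d : ℝ)) * (3 * v) = 6 * v * d := by ring
            _ ≤ N * m := hvd
      _ = (N : ℝ) ^ m := by rw [mul_div_assoc, div_self hmpos.ne', mul_one]
  exact_mod_cast key

/-- `ℕ → ℝ≥0∞`: `A · C ≤ B` gives `A / B ≤ C⁻¹` (`C ≠ 0`). [folklore] -/
theorem natCast_div_le_inv_of_mul_le {A B C : ℕ} (h : A * C ≤ B) (hC : C ≠ 0) :
    ((A : ℕ) : ℝ≥0∞) / ((B : ℕ) : ℝ≥0∞) ≤ (((C : ℕ) : ℝ≥0∞))⁻¹ := by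
  rcases Nat.eq_zero_or_pos B with hB | hB
  · subst hB
    have hA : A = 0 := by
      rcases Nat.eq_zero_or_pos A with hA | hA
      · exact hA
      · exfalso
        have : 0 < A * C := Nat.mul_pos hA (Nat.pos_of_ne_zero hC)
        omega
    subst hA
    simp
  have hB0 : ((B : ℕ) : ℝ≥0∞) ≠ 0 := by exact_mod_cast hB.ne'
  have hC0 : ((C : ℕ) : ℝ≥0∞) ≠ 0 := by exact_mod_cast hC
  rw [ENNReal.div_le_iff hB0 (ENNReal.natCast_ne_top _),
    ← ENNReal.mul_le_iff_le_inv hC0 (ENNReal.natCast_ne_top _)]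
  rw [mul_comm] at h
  exact_mod_cast h

/-- `2⁻¹ ^ m ≤ (N)⁻¹` in `ℝ≥0∞` as soon as `N ≤ 2^m`. [folklore] -/
theorem half_pow_le_inv_natCast {N m : ℕ} (h : N ≤ 2 ^ m) :
    (2⁻¹ : ℝ≥0∞) ^ m ≤ (((N : ℕ) : ℝ≥0∞))⁻¹ := by
  rw [← ENNReal.inv_pow, ENNReal.inv_le_inv]
  exact_mod_cast h

/-! ### Vertices of a term -/

/-- A term with `s` edge slots meets at most `2s` vertices. [folklore] -/
theorem card_vertices_le_two_mul_card (E : Finset (⊤ : SimpleGraph (Fin n)).edgeSet) :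
    #(univ.filter fun v : Fin n => ∃ e ∈ E, v ∈ (e : Sym2 (Fin n))) ≤ 2 * #E := by
  classical
  have hsub : (univ.filter fun v : Fin n => ∃ e ∈ E, v ∈ (e : Sym2 (Fin n))) ⊆
      E.biUnion fun e => univ.filter fun v : Fin n => v ∈ (e : Sym2 (Fin n)) := by
    intro v hv
    rw [mem_filter] at hv
    obtain ⟨e, he, hve⟩ := hv.2
    exact mem_biUnion.2 ⟨e, he, mem_filter.2 ⟨mem_univ _, hve⟩⟩
  calc #(univ.filter fun v : Fin n => ∃ e ∈ E, v ∈ (e : Sym2 (Fin n)))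
      ≤ #(E.biUnion fun e => univ.filter fun v : Fin n => v ∈ (e : Sym2 (Fin n))) := card_le_card hsub
    _ ≤ ∑ e ∈ E, #(univ.filter fun v : Fin n => v ∈ (e : Sym2 (Fin n))) := card_biUnion_le
    _ = ∑ _e ∈ E, 2 := sum_congr rfl fun e _ => card_filter_mem_edge e
    _ = 2 * #E := by rw [sum_const, smul_eq_mul, mul_comm]

/-- A term meets at most `n` vertices. [folklore] -/
theorem card_vertices_le (E : Finset (⊤ : SimpleGraph (Fin n)).edgeSet) :
    #(univ.filter fun v : Fin n => ∃ e ∈ E, v ∈ (e : Sym2 (Fin n))) ≤ n :=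
  (card_le_univ _).trans_eq (Fintype.card_fin n)

/-! ### The three numeric bounds -/

/-- **Small terms.** If `v ≤ 2 L⁴` and `(2 L⁴ d)² ≤ n` then `C(v, 2(c+2)) d^{2(c+2)} / n^{2(c+2)} ≤ (n^{c+2})⁻¹`.
[folklore] -/
theorem dnf_smallTerm_le_inv {v d L c : ℕ} (hn : 0 < n) (hv : v ≤ 2 * L ^ 4) (H1 : (2 * L ^ 4 * d) ^ 2 ≤ n) :
    ((v.choose (2 * (c + 2)) * d ^ (2 * (c + 2)) : ℕ) : ℝ≥0∞) / ((n ^ (2 * (c + 2)) : ℕ) : ℝ≥0∞) ≤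
      (((n ^ (c + 2) : ℕ) : ℝ≥0∞))⁻¹ := by
  refine natCast_div_le_inv_of_mul_le ?_ (pow_pos hn _).ne'
  have hA : v.choose (2 * (c + 2)) * d ^ (2 * (c + 2)) ≤ n ^ (c + 2) :=
    calc v.choose (2 * (c + 2)) * d ^ (2 * (c + 2))
        ≤ v ^ (2 * (c + 2)) * d ^ (2 * (c + 2)) := Nat.mul_le_mul_right _ (Nat.choose_le_pow _ _)
      _ ≤ (2 * L ^ 4) ^ (2 * (c + 2)) * d ^ (2 * (c + 2)) :=
          Nat.mul_le_mul_right _ (Nat.pow_le_pow_left hv _)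
      _ = ((2 * L ^ 4 * d) ^ 2) ^ (c + 2) := by rw [← mul_pow, ← pow_mul]
      _ ≤ n ^ (c + 2) := Nat.pow_le_pow_left H1 _
  calc v.choose (2 * (c + 2)) * d ^ (2 * (c + 2)) * n ^ (c + 2) ≤ n ^ (c + 2) * n ^ (c + 2) :=
        Nat.mul_le_mul_right _ hA
    _ = n ^ (2 * (c + 2)) := by rw [← pow_add, two_mul]

/-- `2 L² ≤ L⁴ + 1`. [folklore] -/
theorem two_mul_sq_le_pow_four_add_one (L : ℕ) : 2 * L ^ 2 ≤ L ^ 4 + 1 := by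
  have h : (2 * L ^ 2 : ℤ) ≤ L ^ 4 + 1 := by nlinarith [sq_nonneg ((L : ℤ) ^ 2 - 1)]
  exact_mod_cast h

/-- `n^{c+2} ≤ 2^{L²}` when `c + 3 ≤ L` and `n < 2^{L+1}`. [folklore] -/
theorem pow_le_two_pow_sq {L c : ℕ} (hL : c + 3 ≤ L) (hnL : n < 2 ^ (L + 1)) : n ^ (c + 2) ≤ 2 ^ (L ^ 2) := by
  have h1 : n ^ (c + 2) ≤ (2 ^ (L + 1)) ^ (c + 2) := Nat.pow_le_pow_left hnL.le _
  have h2 : (L + 1) * (c + 2) ≤ L ^ 2 := by nlinarith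
  calc n ^ (c + 2) ≤ (2 ^ (L + 1)) ^ (c + 2) := h1
    _ = 2 ^ ((L + 1) * (c + 2)) := by rw [← pow_mul]
    _ ≤ 2 ^ (L ^ 2) := Nat.pow_le_pow_right two_pos h2

/-- **Large terms, first summand.** For `s > L⁴`: `2^{-(s - C(⌊√s⌋,2))} ≤ 2^{-L²} ≤ (n^{c+2})⁻¹`. [folklore] -/
theorem dnf_largeTerm_half_pow_le_inv {s L c : ℕ} (hs : L ^ 4 < s) (hL : c + 3 ≤ L) (hnL : n < 2 ^ (L + 1)) :
    (2⁻¹ : ℝ≥0∞) ^ (s - (Nat.sqrt s).choose 2) ≤ (((n ^ (c + 2) : ℕ) : ℝ≥0∞))⁻¹ := by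
  refine half_pow_le_inv_natCast ((pow_le_two_pow_sq hL hnL).trans (Nat.pow_le_pow_right two_pos ?_))
  have h1 := choose_sqrt_two_le_half s
  have h2 := two_mul_sq_le_pow_four_add_one L
  omega

/-- `⌊√s⌋ ≥ L²` when `s > L⁴`. [folklore] -/
theorem sq_le_sqrt_of_pow_four_lt {s L : ℕ} (hs : L ^ 4 < s) : L ^ 2 ≤ Nat.sqrt s := by
  have h : Nat.sqrt (L ^ 2 * L ^ 2) = L ^ 2 := Nat.sqrt_eq (L ^ 2)
  rw [← h]
  exact Nat.sqrt_le_sqrt (by rw [← pow_add]; exact hs.le)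

/-- **Large terms, second summand.** For `s > L⁴`, `v ≤ min(n, 2s)`, with `12(⌊√n⌋+1) d ≤ n`, `6d ≤ ⌊√n⌋ + 1`,
`c + 3 ≤ L`, `n < 2^{L+1}`: `C(v, ⌊√s⌋+1) d^{⌊√s⌋+1} / n^{⌊√s⌋+1} ≤ (n^{c+2})⁻¹` (via `6 v d ≤ n (⌊√s⌋+1)` and
`choose_mul_pow_le_pow_of_le`, then `2^{⌊√s⌋+1} ≥ 2^{L²} ≥ n^{c+2}`). [folklore] -/
theorem dnf_largeTerm_tail_le_inv {s v d L c : ℕ} (hn : 0 < n) (hs : L ^ 4 < s) (hv2 : v ≤ 2 * s)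
    (hvn : v ≤ n) (H2 : 12 * (Nat.sqrt n + 1) * d ≤ n) (H3 : 6 * d ≤ Nat.sqrt n + 1) (hL : c + 3 ≤ L)
    (hnL : n < 2 ^ (L + 1)) :
    ((v.choose (Nat.sqrt s + 1) * d ^ (Nat.sqrt s + 1) : ℕ) : ℝ≥0∞) /
        ((n ^ (Nat.sqrt s + 1) : ℕ) : ℝ≥0∞) ≤ (((n ^ (c + 2) : ℕ) : ℝ≥0∞))⁻¹ := by
  set m := Nat.sqrt s + 1 with hm
  -- (i) `6 v d ≤ n m`
  have hkey : 6 * v * d ≤ n * m := by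
    rcases le_or_gt s n with hsn | hsn
    · -- `v ≤ 2 s ≤ 2 m²`, `12 m d ≤ n`
      have hsm : s ≤ m * m := (Nat.lt_succ_sqrt s).le
      have hmn : m ≤ Nat.sqrt n + 1 := Nat.succ_le_succ (Nat.sqrt_le_sqrt hsn)
      have h12 : 12 * m * d ≤ n :=
        calc 12 * m * d ≤ 12 * (Nat.sqrt n + 1) * d :=
            Nat.mul_le_mul_right _ (Nat.mul_le_mul_left _ hmn)
          _ ≤ n := H2
      calc 6 * v * d ≤ 6 * (2 * (m * m)) * d := by gcongr; exact hv2.trans (Nat.mul_le_mul_left _ hsm)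
        _ = (12 * m * d) * m := by ring
        _ ≤ n * m := Nat.mul_le_mul_right _ h12
    · -- `v ≤ n`, `6 d ≤ ⌊√n⌋ + 1 ≤ m`
      have hmn : Nat.sqrt n + 1 ≤ m := Nat.succ_le_succ (Nat.sqrt_le_sqrt hsn.le)
      calc 6 * v * d ≤ 6 * n * d := by gcongr
        _ = n * (6 * d) := by ring
        _ ≤ n * m := Nat.mul_le_mul_left _ (H3.trans hmn)
  -- (ii) `C(v,m) (2d)^m ≤ n^m`
  have hcm := choose_mul_pow_le_pow_of_le v d n m (Nat.succ_pos _) hkey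
  -- (iii) `n^{c+2} ≤ 2^m`
  have h2m : n ^ (c + 2) ≤ 2 ^ m := by
    refine (pow_le_two_pow_sq hL hnL).trans (Nat.pow_le_pow_right two_pos ?_)
    exact (sq_le_sqrt_of_pow_four_lt hs).trans (Nat.le_succ _)
  refine natCast_div_le_inv_of_mul_le ?_ (pow_pos hn _).ne'
  calc v.choose m * d ^ m * n ^ (c + 2) ≤ v.choose m * d ^ m * 2 ^ m := Nat.mul_le_mul_left _ h2m
    _ = v.choose m * (2 * d) ^ m := by rw [mul_pow]; ring
    _ ≤ n ^ m := hcm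

/-! ### Every term's heavy-witness term is `≤ 2 (n^{c+2})⁻¹` -/

/-- **Uniform per-term bound.** Under the four numeric hypotheses, for EVERY term `E` the heavy-witness term at
threshold `t = C(2(c+2) - 1, 2)` is at most `2 · (n^{c+2})⁻¹`: small terms (`≤ L⁴` slots) by `dnf_termBound_tail` +
`dnf_smallTerm_le_inv`, large terms by `dnf_termBound_large` + `dnf_largeTerm_half_pow_le_inv` +
`dnf_largeTerm_tail_le_inv`. [folklore] -/
theorem dnf_termBound_two_inv (hn : 0 < n) (k : ℕ) {L c : ℕ} (H1 : (2 * L ^ 4 * (min k n)) ^ 2 ≤ n)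
    (H2 : 12 * (Nat.sqrt n + 1) * (min k n) ≤ n) (H3 : 6 * (min k n) ≤ Nat.sqrt n + 1) (hL : c + 3 ≤ L)
    (hnL : n < 2 ^ (L + 1)) (E : Finset (⊤ : SimpleGraph (Fin n)).edgeSet) :
    ((#(kSubsets n k) : ℕ) : ℝ≥0∞)⁻¹ *
      (∑ A ∈ kSubsets n k,
        if (2 * (c + 2) - 1).choose 2 <
            #(E.filter fun e : (⊤ : SimpleGraph (Fin n)).edgeSet => ∀ v ∈ (e : Sym2 (Fin n)), v ∈ A) then
          (erdosRenyiHalf n).toOuterMeasure {x | ∀ e ∈ E, plant A x e = true} else 0) ≤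
      2 * (((n ^ (c + 2) : ℕ) : ℝ≥0∞))⁻¹ := by
  have hv2 := card_vertices_le_two_mul_card E
  have hvn := card_vertices_le E
  rcases le_or_gt #E (L ^ 4) with hsmall | hlarge
  · refine (dnf_termBound_tail hn k (2 * (c + 2)) E).trans ?_
    refine (dnf_smallTerm_le_inv (L := L) hn (hv2.trans (Nat.mul_le_mul_left _ hsmall)) H1).trans ?_
    rw [two_mul]
    exact le_add_self
  · refine (dnf_termBound_large hn k _ E).trans ?_
    rw [two_mul]
    exact add_le_add (dnf_largeTerm_half_pow_le_inv hlarge hL hnL)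
      (dnf_largeTerm_tail_le_inv hn hlarge hv2 hvn H2 H3 hL hnL)

end Summit.PneNP.PneNP.Theorems
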